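import Summits.BirchSwinnertonDyer.BirchSwinnertonDyer.Theorems.SignedLowerHalvesKobayashiLowerHalfSemistableMuSplit
import HarnessLib

/-!
# Crux `KobayashiMainConjectureSmallImage` (item stmt-BirchSwinnertonDyer-19002), ideator `bsd-idea-13` gen 4, lens = strengthen —
# «partner-μ rider»: in an INTEGRAL product lower divisibility the one-sign ANALYTIC `μ`-rider of the principal curve can be traded
# for the KATO-direction `μ`-inequality of the AUXILIARY twists (pure `Λ`-algebra; a SKETCH — registers nothing, proves no crux;
# BSD is not proved by any of this)

WHAT THIS IS. The LEAD's line «acns» on this crux (`Theorems/SignedLowerHalvesKobayashiMainConjectureSmallImageAcnsDescent.lean`,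
`…AcnsCrux.lean`, p620906 / p621671) descends the two-variable signed equality `T3 = CanonicalNs` over the anticyclotomically
non-scalar frame `(K, ℓ)` to the cyclotomic line, where it reads — BEFORE any `μ` is discarded — as an integral PRODUCT divisibility
`L^ε(E) · ∏ᵢ L^ε(Eᵢ) ∣ u · g_E · ∏ᵢ g_{Eᵢ}` over the three auxiliary quadratic twists `Eᵢ ∈ {E^{(D_K)}, E^{(ℓ*)}, E^{(ℓ* D_K)}}`
(`g_•` generators of `char X^ε(•/ℚ_∞)`, `u ∈ Λˣ` the canonical-period ratio). The LEAD splits the product with RATIONAL Kato for the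
auxiliaries (image-free, Kobayashi 2003 Thm 4.1 rational clause) and then needs ONE extra input to make the principal factor integral:
the analytic rider `hμan₀ : μ(L^ε(E)) = 0` (`MuSplit.dvd_of_dvd_C_pow_mul_of_mu_eq_zero'`).

THE RIDER VARIANT (this file, §1–§2). The same split goes through with `hμan₀` REPLACED by the joint Kato-direction `μ`-inequality of
the auxiliary block, `μ(∏ᵢ g_{Eᵢ}) ≤ μ(∏ᵢ L^ε(Eᵢ))` — in particular by `μ(X^ε(Eᵢ/ℚ_∞)) = 0` for the three auxiliaries — because `μ`
is additive on `Λ ∖ {0}` (`X1.MuLambda.mu_mul`, Gauss) and monotone along divisibility (`MuSplit.mu_le_mu_of_dvd`):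
`μ(L_E) + μ(M) ≤ μ(g_E) + μ(h) ≤ μ(g_E) + μ(M)`. Typed: `dvd_of_mul_dvd_mul_of_dvd_C_pow_mul_of_mu_le` (§1) and the two-block
aggregation `mul_dvd_C_pow_mul_mul` / `mu_mul_le_mu_mul` (§2; apply twice for three auxiliaries).

HONEST VALUE (numbers, not adjectives). Per pair the variant is WEAKER than `hμan₀`: `hμan₀(E, ε)` is ONE modular-symbol computation
mod `p`; the variant asks for THREE algebraic certificates `μ(X^ε(Eᵢ)) = 0`, two of them on ODD-rank twists (for `r_an(E) = 0` and a
Heegner frame, `E^{(D_K)}` and one of `E^{(ℓ*)}, E^{(ℓ* D_K)}` have odd analytic rank), where B. D. Kim 2013 Cor. 3.15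
(`signedMu_eq_zero_of_selmerTrivial`) does not apply directly — it applies to a CONGRUENT rank-0 partner (B. D. Kim 2009 Cor. 2.13,
`mu_eq_zero_of_unitPartner`), e.g. the shadow self-twist `Eᵢ^{(d_M)}` (`Eᵢ[p] ≅ Eᵢ^{(d_M)}[p]` at normaliser-of-Cartan image, cell memo
k3c4-MEMO-9 §4), subject to the Selmer-companion identity (k3c4-MEMO-10 R10: with `p ∤ ∏c` on both sides the `p`-Selmer groups of
congruent partners COINCIDE, so a partner helps only when `p ∣ ∏c(Eᵢ)`). Class-wide NEITHER rider has a source: `hμan₀` is Greenberg's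
`μ`-conjecture territory for one sign (Pollack 2003 Conj. 6.3), the variant is the `μ`-part of Kato's divisibility for `ρ̄ ⊗ χ` at the
SAME (normaliser-of-Cartan) projective image, where no integral Euler-system bound is in print
(`Literature.Barriers.BirchSwinnertonDyer.EulerSystemBigImageAtSmallImage`). Verdict of the ideator: NOT a lever with teeth — recorded so
that the rider menu of line «acns» is complete (analytic `μ` of `E` | algebraic `μ` of the auxiliaries | any mix with
`Σ μ(gᵢ) ≤ Σ μ(Lᵢ)`), and because the variant is the form a future class-wide ALGEBRAIC `μ = 0` theorem for twists would plug into.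

References: [GreenbergVatsal2000] p. 4 (1)–(2); [Washington1997] §7.1; [Kobayashi2003] Thm. 1.2 / 4.1; [BDKim2013] Cor. 3.15;
[BDKim2009] Cor. 2.13; [Pollack2003] Conj. 6.3. Cell memos: `run/shared/lean/pub/bsd-ssimc/k3c4-MEMO-9.md` §4, `k3c4-MEMO-10.md` §6 (R10).
-/

set_option autoImplicit false
set_option linter.dupNamespace false

noncomputable section

open scoped Classical

open Literature.NumberTheory.EllipticCurves Summit.BirchSwinnertonDyer.Rank1Residual
  Summit.BirchSwinnertonDyer.Rank1Residual.X1 Summit.BirchSwinnertonDyer.BirchSwinnertonDyer.Theorems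

namespace Summit.BirchSwinnertonDyer.BirchSwinnertonDyer.Cruxes.KobayashiMainConjectureSmallImage.PartnerMu

variable {p : ℕ} [Fact p.Prime]

/-! ### §1 The split: product divisibility + rational Kato for the auxiliary block + `μ`-inequality of the block ⇒ integral principal -/

/-- `C(p)^t ≠ 0` in `Λ = ℤ_p⟦T⟧`. [folklore] -/
theorem C_p_pow_ne_zero (t : ℕ) : (PowerSeries.C (p : ℤ_[p]) ^ t : IwasawaAlgebra p) ≠ 0 :=
  pow_ne_zero t (IwasawaAlgebra.prime_C p).ne_zero

/-- **Partner-`μ` split.** In `Λ = ℤ_p⟦T⟧`: if `L₁ · M ∣ g₁ · h` (integral product divisibility: principal analytic `L₁`, auxiliary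
analytic block `M ≠ 0`, principal algebraic `g₁ ≠ 0`, auxiliary algebraic block `h`), if `h ∣ p^t · M` (RATIONAL Kato for the auxiliary
block) and if `μ(h) ≤ μ(M)` (the Kato-direction `μ`-inequality of the block), then `L₁ ∣ g₁` — integrally, with NO hypothesis on `μ(L₁)`.
Proof: cancel `h ≠ 0` to get `L₁ ∣ p^t g₁`; `μ(L₁) + μ(M) = μ(L₁M) ≤ μ(g₁h) = μ(g₁) + μ(h) ≤ μ(g₁) + μ(M)`; conclude by the `μ`-split
criterion `MuSplit.dvd_iff_exists_dvd_C_pow_mul_and_mu_le`. [cite: GreenbergVatsal2000, p. 4, (1)–(2)] [cite: Washington1997, §7.1] -/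
theorem dvd_of_mul_dvd_mul_of_dvd_C_pow_mul_of_mu_le {L₁ M g₁ h : IwasawaAlgebra p}
    (hM : M ≠ 0) (hg₁ : g₁ ≠ 0) (hprod : L₁ * M ∣ g₁ * h)
    {t : ℕ} (hKato : h ∣ PowerSeries.C (p : ℤ_[p]) ^ t * M)
    (hμ : MuLambda.mu h ≤ MuLambda.mu M) : L₁ ∣ g₁ := by
  have hh : h ≠ 0 := by
    rintro rfl
    obtain ⟨k, hk⟩ := hKato
    exact (mul_ne_zero (C_p_pow_ne_zero t) hM) (by simpa using hk)
  have hL₁ : L₁ ≠ 0 := by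
    rintro rfl
    obtain ⟨k, hk⟩ := hprod
    exact (mul_ne_zero hg₁ hh) (by simpa using hk)
  obtain ⟨k, hk⟩ := hprod
  obtain ⟨j, hj⟩ := hKato
  rw [MuSplit.dvd_iff_exists_dvd_C_pow_mul_and_mu_le hg₁]
  refine ⟨⟨t, ⟨j * k, ?_⟩⟩, ?_⟩
  · apply mul_left_cancel₀ hh
    calc h * (PowerSeries.C (p : ℤ_[p]) ^ t * g₁)
        = PowerSeries.C (p : ℤ_[p]) ^ t * (g₁ * h) := by ring
      _ = PowerSeries.C (p : ℤ_[p]) ^ t * (L₁ * M * k) := by rw [hk]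
      _ = L₁ * k * (PowerSeries.C (p : ℤ_[p]) ^ t * M) := by ring
      _ = L₁ * k * (h * j) := by rw [hj]
      _ = h * (L₁ * (j * k)) := by ring
  · have h1 : MuLambda.mu (L₁ * M) ≤ MuLambda.mu (g₁ * h) :=
      MuSplit.mu_le_mu_of_dvd (mul_ne_zero hg₁ hh) ⟨k, hk⟩
    rw [MuLambda.mu_mul hL₁ hM, MuLambda.mu_mul hg₁ hh] at h1
    omega

/-- The special case the rider is usually quoted in: ALGEBRAIC `μ = 0` for the auxiliary block (`μ(h) = 0`, e.g. from
`μ(X^ε(Eᵢ/ℚ_∞)) = 0` for each auxiliary twist) makes the principal divisibility integral. [cite: GreenbergVatsal2000, p. 4, (1)–(2)] -/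
theorem dvd_of_mul_dvd_mul_of_dvd_C_pow_mul_of_mu_eq_zero {L₁ M g₁ h : IwasawaAlgebra p}
    (hM : M ≠ 0) (hg₁ : g₁ ≠ 0) (hprod : L₁ * M ∣ g₁ * h)
    {t : ℕ} (hKato : h ∣ PowerSeries.C (p : ℤ_[p]) ^ t * M) (hμ : MuLambda.mu h = 0) : L₁ ∣ g₁ :=
  dvd_of_mul_dvd_mul_of_dvd_C_pow_mul_of_mu_le hM hg₁ hprod hKato (hμ ▸ Nat.zero_le _)

/-- The product divisibility usually arrives with a UNIT (the canonical-period ratio): `L₁ · M ∣ u · (g₁ · h)`, `IsUnit u`. Absorb `u`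
into the auxiliary algebraic block (`μ` and the rational Kato bound are unit-invariant). [cite: GreenbergVatsal2000, p. 4, (1)–(2)] -/
theorem dvd_of_mul_dvd_unit_mul_of_dvd_C_pow_mul_of_mu_le {L₁ M g₁ h u : IwasawaAlgebra p} (hu : IsUnit u)
    (hM : M ≠ 0) (hg₁ : g₁ ≠ 0) (hprod : L₁ * M ∣ u * (g₁ * h))
    {t : ℕ} (hKato : h ∣ PowerSeries.C (p : ℤ_[p]) ^ t * M)
    (hμ : MuLambda.mu h ≤ MuLambda.mu M) : L₁ ∣ g₁ := by
  have hprod' : L₁ * M ∣ g₁ * (u * h) := by simpa [mul_comm, mul_left_comm, mul_assoc] using hprod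
  have hKato' : u * h ∣ PowerSeries.C (p : ℤ_[p]) ^ t * M := hu.mul_left_dvd.mpr hKato
  by_cases hh : h = 0
  · subst hh
    obtain ⟨k, hk⟩ := hKato
    exact absurd (by simpa using hk) (mul_ne_zero (C_p_pow_ne_zero t) hM)
  have hμ' : MuLambda.mu (u * h) ≤ MuLambda.mu M := by
    rw [MuLambda.mu_mul hu.ne_zero hh, ((MuLambda.isUnit_iff_mu_eq_zero_and_lam_eq_zero u).mp hu).2.1, zero_add]
    exact hμ
  exact dvd_of_mul_dvd_mul_of_dvd_C_pow_mul_of_mu_le hM hg₁ hprod' hKato' hμ'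

/-! ### §2 Aggregating the auxiliary block (two factors; apply twice for the three auxiliaries of the frame `(K, ℓ)`) -/

/-- Rational Kato bounds multiply: `g₂ ∣ p^a L₂`, `g₃ ∣ p^b L₃` ⇒ `g₂ g₃ ∣ p^{a+b} (L₂ L₃)`. [folklore] -/
theorem mul_dvd_C_pow_mul_mul {g₂ g₃ L₂ L₃ : IwasawaAlgebra p} {a b : ℕ}
    (h₂ : g₂ ∣ PowerSeries.C (p : ℤ_[p]) ^ a * L₂) (h₃ : g₃ ∣ PowerSeries.C (p : ℤ_[p]) ^ b * L₃) :
    g₂ * g₃ ∣ PowerSeries.C (p : ℤ_[p]) ^ (a + b) * (L₂ * L₃) := by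
  have := mul_dvd_mul h₂ h₃
  simpa [pow_add, mul_comm, mul_left_comm, mul_assoc] using this

/-- Kato-direction `μ`-inequalities add: `μ(g₂) ≤ μ(L₂)`, `μ(g₃) ≤ μ(L₃)` (all four nonzero) ⇒ `μ(g₂g₃) ≤ μ(L₂L₃)`.
[cite: Washington1997, §7.1] -/
theorem mu_mul_le_mu_mul {g₂ g₃ L₂ L₃ : IwasawaAlgebra p} (hg₂ : g₂ ≠ 0) (hg₃ : g₃ ≠ 0) (hL₂ : L₂ ≠ 0) (hL₃ : L₃ ≠ 0)
    (h₂ : MuLambda.mu g₂ ≤ MuLambda.mu L₂) (h₃ : MuLambda.mu g₃ ≤ MuLambda.mu L₃) :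
    MuLambda.mu (g₂ * g₃) ≤ MuLambda.mu (L₂ * L₃) := by
  rw [MuLambda.mu_mul hg₂ hg₃, MuLambda.mu_mul hL₂ hL₃]
  omega

/-- A block with `μ = 0` factorwise has `μ = 0` (nonzero factors). [cite: Washington1997, §7.1] -/
theorem mu_mul_eq_zero {g₂ g₃ : IwasawaAlgebra p} (hg₂ : g₂ ≠ 0) (hg₃ : g₃ ≠ 0)
    (h₂ : MuLambda.mu g₂ = 0) (h₃ : MuLambda.mu g₃ = 0) : MuLambda.mu (g₂ * g₃) = 0 := by
  rw [MuLambda.mu_mul hg₂ hg₃, h₂, h₃]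

/-! ### §3 The three-auxiliary reading (the shape line «acns» produces on the cyclotomic line)

For the frame `(K, ℓ)` of `…SmallImageTwoVariableInputsNoSurj.lean` the cyclotomic specialisation of `T3 = CanonicalNs` is (after
Rohrlich non-vanishing of the three auxiliary signed `p`-adic `L`-functions and the unit period ratio `u`) an instance of `hprod` below
with `M = L₂ L₃ L₄`, `h = g₂ g₃ g₄`; rational Kato for each auxiliary gives `hKato` by `mul_dvd_C_pow_mul_mul` twice; the rider is
`μ(g₂ g₃ g₄) ≤ μ(L₂ L₃ L₄)`, implied by `μ(gᵢ) ≤ μ(Lᵢ)` factorwise (`mu_mul_le_mu_mul` twice) and in particular by `μ(gᵢ) = 0`. -/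

/-- **Three-auxiliary partner-`μ` split** (the statement a successor LEAD would call): principal `L₁ ∣ g₁` from the four-factor
integral product divisibility with a unit, three rational Kato bounds, non-vanishing of the auxiliary analytic factors, and the three
Kato-direction `μ`-inequalities of the auxiliaries — no hypothesis on `μ(L₁)`. [cite: GreenbergVatsal2000, p. 4, (1)–(2)]
[cite: Kobayashi2003, Thm. 4.1] -/
theorem dvd_of_prod_four_dvd {L₁ L₂ L₃ L₄ g₁ g₂ g₃ g₄ u : IwasawaAlgebra p} (hu : IsUnit u)
    (hL₂ : L₂ ≠ 0) (hL₃ : L₃ ≠ 0) (hL₄ : L₄ ≠ 0) (hg₁ : g₁ ≠ 0) (hg₂ : g₂ ≠ 0) (hg₃ : g₃ ≠ 0) (hg₄ : g₄ ≠ 0)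
    (hprod : L₁ * (L₂ * L₃ * L₄) ∣ u * (g₁ * (g₂ * g₃ * g₄)))
    {a b c : ℕ} (hK₂ : g₂ ∣ PowerSeries.C (p : ℤ_[p]) ^ a * L₂) (hK₃ : g₃ ∣ PowerSeries.C (p : ℤ_[p]) ^ b * L₃)
    (hK₄ : g₄ ∣ PowerSeries.C (p : ℤ_[p]) ^ c * L₄)
    (hμ₂ : MuLambda.mu g₂ ≤ MuLambda.mu L₂) (hμ₃ : MuLambda.mu g₃ ≤ MuLambda.mu L₃) (hμ₄ : MuLambda.mu g₄ ≤ MuLambda.mu L₄) :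
    L₁ ∣ g₁ := by
  have hK : g₂ * g₃ * g₄ ∣ PowerSeries.C (p : ℤ_[p]) ^ (a + b + c) * (L₂ * L₃ * L₄) :=
    mul_dvd_C_pow_mul_mul (mul_dvd_C_pow_mul_mul hK₂ hK₃) hK₄
  have hμ : MuLambda.mu (g₂ * g₃ * g₄) ≤ MuLambda.mu (L₂ * L₃ * L₄) :=
    mu_mul_le_mu_mul (mul_ne_zero hg₂ hg₃) hg₄ (mul_ne_zero hL₂ hL₃) hL₄ (mu_mul_le_mu_mul hg₂ hg₃ hL₂ hL₃ hμ₂ hμ₃) hμ₄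
  exact dvd_of_mul_dvd_unit_mul_of_dvd_C_pow_mul_of_mu_le hu (mul_ne_zero (mul_ne_zero hL₂ hL₃) hL₄) hg₁ hprod hK hμ

end Summit.BirchSwinnertonDyer.BirchSwinnertonDyer.Cruxes.KobayashiMainConjectureSmallImage.PartnerMu

end
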